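/-
Copyright (c) 2026 the pub-hodgecm-mathlib formalisation cell (harness21).  Prover seat hodgecm-mathlib-LH7-p04 (g3), 2026-09-02 (LH7 leaf ED. 3 road,
print organ O8a `PKsaU2Shape`, steps (3)+(4)+(5a) glued: «one local `SU(F_{v₁})` fixes `P` + strong approximation ⇒ `SU(𝔸)` fixes `P` ⇒
`P` is an automorphic character»).
-/
import Literature.NumberTheory.Automorphic.AutomorphicQuotientSaturationNormal
import Literature.NumberTheory.Automorphic.AutomorphicScalarSubgroup
import HarnessLib

/-!
# From one local fixing group to an automorphic character: Kneser saturation on a discrete automorphic representation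

Topic `NumberTheory/Automorphic`; THEOREMS ONLY (no definition, no instance, no named fact, no notation, no `sorry`).  Glue over ★
`AutomorphicQuotientSaturationNormal` (Kneser saturation, normal form) and ★ `AutomorphicScalarSubgroup` (trivial derived action ⇒ `ofChar`),
in the shape the O8a assembly consumes: the fixing data are a SET `S₁ ⊆ G(𝔸_K)` fixing EVERY vector of `P` (no level, no smooth vectors) and a
set `D ⊆ A_G · G(K)`; the closed normal subgroup over which one strictifies is manufactured here as the topological closure of the normal closure of
`S₁`, which still fixes every vector of `P` (the fixator of all of `P` is a CLOSED subgroup stable under conjugation, by strong continuity and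
`G(𝔸_K)`-invariance of `P`).

* §1 `DiscreteAutomorphicRep.toContRep_apply_eq_self_of_mem_topologicalClosure_normalClosure` — if every `s ∈ S₁` fixes every vector of `P`, so does
  every element of `(normalClosure S₁).topologicalClosure`;
  **`DiscreteAutomorphicRep.toContRep_apply_eq_self_of_subset_closure`** — with `N ⊴ G(𝔸_K)` closed normal and
  `N ⊆ closure ⟨D ∪ S₁⟩` (`D ⊆ A_G · G(K)`): every `n ∈ N` fixes every vector of `P` (★ Kneser, normal form);
* §2 **`DiscreteAutomorphicRep.exists_eq_ofChar_of_subset_closure_of_commutator_mem`** — if moreover a closed normal `M` with `M · (A_G · G(K))`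
  dense has all its commutators `g⁻¹ m⁻¹ g m` in `N`, then `P = ofChar ψ μ` for an automorphic character `ψ` (★ `AutomorphicScalarSubgroup`);
  **`UnitaryGroup.exists_eq_ofChar_of_subset_closure_of_commutator_mem`** — the unitary-datum form with `M = U(J)(𝔸_{F,f})` under weak
  approximation at `∞` (★ `UnitaryGroupFiniteAdelicDenseOrbit`).

CONSUMER (cell `hodgecm-mathlib`, crux H413 = stmt-HodgeConjecture-24833, LH7 ∕ O8a `PKsaU2Shape`, assembly (6)): `S₁ := inclPlaceAdelic v₁ '' {u | det u = 1}`
(fixes `P` by ★ `DiscreteAutomorphicRepConjStableFixed` + ★ `UnitaryGroupRankTwoLocalCharacterIsotypy`), `D := toAdelic '' {γ | det γ = 1}`,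
`N := {det = 1}` (ker of ★ `adelicDet`), `hdense` := ★ `UnitaryGroup.mem_topologicalClosure_of_det_eq_one` ((M1) strong approximation),
`hcomm` := «`det (g⁻¹ b⁻¹ g b) = 1`», `hWA` := ★ `denseRange_archPart_toAdelic_cm`; output `P = ofChar ψ`, then ★ `UnitaryGroupDetCharacterSection`
gives `ψ = cmDetChar θ`.  Nothing here is specific to unitary groups before the last theorem.
HONEST LABEL: generic `L²` bookkeeping; HC_CM is proved only modulo the printed citations of that programme until its rung 0 closes.

References: [PlatonovRapinchuk1994] §7.4 (Thm. 7.12; proof of Prop. 7.13); [Kneser1966]; [BorelJacquet1979] §4.6; [Zimmer1984] §2.2, App. B.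
-/

set_option autoImplicit false

noncomputable section

open MeasureTheory Filter Set Topology NumberField
open scoped Pointwise

namespace Literature.NumberTheory.Automorphic

namespace DiscreteAutomorphicRep

universe u

variable {K : Type} [Field K] [NumberField K] {𝒢 : AdelicGroupData.{u} K}
  (μ : Measure 𝒢.automorphicQuotient) [𝒢.IsAutomorphicMeasure μ]

/-! ## §1 The fixator of `P` is a closed subgroup stable under conjugation; Kneser saturation on `P` -/

/-- **If every element of a set `S₁` fixes every vector of the discrete automorphic `P`, so does every element of the topological closure of the
normal closure of `S₁`**: the fixator `{g | ∀ v ∈ P, R(g) v = v}` is a subgroup, stable under conjugation (`R(g s g⁻¹) v = R(g) R(s) R(g⁻¹) v` and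
`R(g⁻¹) v ∈ P`), and closed (strong continuity of the regular representation, ★ `isStronglyContinuous_rightRegular_holds`).
[cite: BorelJacquet1979, §4.6] -/
theorem toContRep_apply_eq_self_of_mem_topologicalClosure_normalClosure (P : DiscreteAutomorphicRep 𝒢 μ) (S₁ : Set 𝒢.Adelic)
    (hfix : ∀ s ∈ S₁, ∀ v : P.space.toSubmodule, P.space.toContRep s v = v) {g : 𝒢.Adelic}
    (hg : g ∈ ((Subgroup.normalClosure S₁).topologicalClosure : Subgroup 𝒢.Adelic)) (v : P.space.toSubmodule) :
    P.space.toContRep g v = v := by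
  -- the fixator of all of `P`, as a subgroup of `G(𝔸_K)`
  let Fix : Subgroup 𝒢.Adelic :=
    { carrier := {g | ∀ v : P.space.toSubmodule, P.space.toContRep g v = v}
      one_mem' := fun v => by rw [map_one]; rfl
      mul_mem' := fun {a b} ha hb v => by
        rw [map_mul]
        change P.space.toContRep a (P.space.toContRep b v) = v
        rw [hb, ha]
      inv_mem' := fun {a} ha v => by
        have h1 : (P.space.toContRep a⁻¹ * P.space.toContRep a) v = v := by rw [← map_mul, inv_mul_cancel, map_one]; rfl
        change P.space.toContRep a⁻¹ (P.space.toContRep a v) = v at h1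
        rwa [ha] at h1 }
  -- conjugates of elements of `S₁` fix `P`
  have hconj : Group.conjugatesOfSet S₁ ⊆ (Fix : Set 𝒢.Adelic) := by
    intro x hx
    obtain ⟨a, ha, hax⟩ := Group.mem_conjugatesOfSet_iff.1 hx
    obtain ⟨c, rfl⟩ := isConj_iff.1 hax
    intro v
    rw [map_mul, map_mul]
    change P.space.toContRep c (P.space.toContRep a (P.space.toContRep c⁻¹ v)) = v
    rw [hfix a ha]
    have h1 : (P.space.toContRep c * P.space.toContRep c⁻¹) v = v := by rw [← map_mul, mul_inv_cancel, map_one]; rfl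
    exact h1
  have hle : Subgroup.normalClosure S₁ ≤ Fix := (Subgroup.closure_le _).2 hconj
  -- the fixator is closed
  have hclosed : IsClosed (Fix : Set 𝒢.Adelic) := by
    have heq : (Fix : Set 𝒢.Adelic) = ⋂ v : P.space.toSubmodule, {g | P.space.toContRep g v = v} := by
      ext g
      simp only [Set.mem_iInter, Set.mem_setOf_eq]
      rfl
    rw [heq]
    refine isClosed_iInter fun v => ?_
    have hsc : Continuous fun g : 𝒢.Adelic => 𝒢.rightRegular μ g (v : 𝒢.L2 μ) :=
      𝒢.isStronglyContinuous_rightRegular_holds μ (v : 𝒢.L2 μ)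
    have hcont : Continuous fun g : 𝒢.Adelic => P.space.toContRep g v := by
      refine continuous_induced_rng.2 ?_
      simp only [Function.comp_def, ContRepresentation.ClosedSubrep.coe_toContRep_apply]
      exact hsc
    exact isClosed_eq hcont continuous_const
  exact (Subgroup.topologicalClosure_minimal _ hle hclosed) hg v

variable [LocallyCompactSpace 𝒢.Adelic] [SecondCountableTopology 𝒢.Adelic]

/-- **Kneser saturation on a discrete automorphic representation.**  Let `N ≤ G(𝔸_K)` be a closed normal subgroup, `S₁ ⊆ G(𝔸_K)` a set of elements
fixing EVERY vector of `P`, and `D ⊆ A_G · G(K)` with `N ⊆ closure ⟨D ∪ S₁⟩` (strong approximation).  Then every `n ∈ N` fixes every vector of `P`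
(★ `AdelicGroupData.rightRegular_apply_eq_self_of_normal_of_subset_closure` with `M₁ = (normalClosure S₁).topologicalClosure`, which is closed,
normal, contains `S₁` and fixes `P` by §1). [cite: PlatonovRapinchuk1994, §7.4 Prop. 7.13 (proof)] [cite: Kneser1966, Hauptsatz] -/
theorem toContRep_apply_eq_self_of_subset_closure (P : DiscreteAutomorphicRep 𝒢 μ) (N : Subgroup 𝒢.Adelic) [N.Normal]
    (hN : IsClosed (N : Set 𝒢.Adelic)) (S₁ : Set 𝒢.Adelic) {D : Set 𝒢.Adelic} (hD : D ⊆ (𝒢.quotientSubgroup : Set 𝒢.Adelic))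
    (hdense : (N : Set 𝒢.Adelic) ⊆ closure ((Subgroup.closure (D ∪ S₁) : Subgroup 𝒢.Adelic) : Set 𝒢.Adelic))
    (hfix : ∀ s ∈ S₁, ∀ v : P.space.toSubmodule, P.space.toContRep s v = v)
    {n : 𝒢.Adelic} (hn : n ∈ N) (v : P.space.toSubmodule) : P.space.toContRep n v = v := by
  set M₁ : Subgroup 𝒢.Adelic := (Subgroup.normalClosure S₁).topologicalClosure with hM₁def
  haveI : M₁.Normal := Subgroup.is_normal_topologicalClosure _
  have hM₁ : IsClosed (M₁ : Set 𝒢.Adelic) := Subgroup.isClosed_topologicalClosure _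
  have hS₁M₁ : S₁ ⊆ (M₁ : Set 𝒢.Adelic) := fun s hs =>
    Subgroup.le_topologicalClosure _ (Subgroup.subset_normalClosure hs)
  have hdense' : (N : Set 𝒢.Adelic) ⊆ closure ((Subgroup.closure (D ∪ (M₁ : Set 𝒢.Adelic)) : Subgroup 𝒢.Adelic) : Set 𝒢.Adelic) := by
    refine hdense.trans (closure_mono (SetLike.coe_subset_coe.2 (Subgroup.closure_mono ?_)))
    exact Set.union_subset_union_right D hS₁M₁
  have hf : ∀ m ∈ M₁, 𝒢.rightRegular μ m (v : 𝒢.L2 μ) = (v : 𝒢.L2 μ) := by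
    intro m hm
    have h1 := congrArg Subtype.val (P.toContRep_apply_eq_self_of_mem_topologicalClosure_normalClosure μ S₁ hfix hm v)
    rw [ContRepresentation.ClosedSubrep.coe_toContRep_apply] at h1
    exact h1
  have h := 𝒢.rightRegular_apply_eq_self_of_normal_of_subset_closure μ N M₁ hN hM₁ hD hdense' hf hn
  apply Subtype.ext
  rw [ContRepresentation.ClosedSubrep.coe_toContRep_apply]
  exact h

/-! ## §2 … and then `P` is the line of an automorphic character -/

/-- **From one local fixing set to an automorphic character.**  In the situation of `toContRep_apply_eq_self_of_subset_closure` (`N` fixes `P`), if a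
closed normal `M ≤ G(𝔸_K)` with `M · (A_G · G(K))` dense has all commutators `g⁻¹ m⁻¹ g m` (`m ∈ M`, `g ∈ G(𝔸_K)`) in `N`, then `P = ofChar ψ μ` for
an automorphic character `ψ` of `G(𝔸_K)` (★ `exists_eq_ofChar_of_forall_mem_apply_eq_self_of_commutator_mem`). [cite: BorelJacquet1979, §4.6]
[cite: Zimmer1984, §2.2 Cor. 2.2.3] -/
theorem exists_eq_ofChar_of_subset_closure_of_commutator_mem (P : DiscreteAutomorphicRep 𝒢 μ) (M N : Subgroup 𝒢.Adelic) [M.Normal] [N.Normal]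
    (hM : IsClosed (M : Set 𝒢.Adelic)) (hd : Dense ((M : Set 𝒢.Adelic) * (𝒢.quotientSubgroup : Set 𝒢.Adelic)))
    (hN : IsClosed (N : Set 𝒢.Adelic)) (S₁ : Set 𝒢.Adelic) {D : Set 𝒢.Adelic} (hD : D ⊆ (𝒢.quotientSubgroup : Set 𝒢.Adelic))
    (hdense : (N : Set 𝒢.Adelic) ⊆ closure ((Subgroup.closure (D ∪ S₁) : Subgroup 𝒢.Adelic) : Set 𝒢.Adelic))
    (hfix : ∀ s ∈ S₁, ∀ v : P.space.toSubmodule, P.space.toContRep s v = v)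
    (hcomm : ∀ m ∈ M, ∀ g : 𝒢.Adelic, g⁻¹ * m⁻¹ * g * m ∈ N) :
    ∃ ψ : 𝒢.AutomorphicCharacter, P = ofChar ψ μ :=
  exists_eq_ofChar_of_forall_mem_apply_eq_self_of_commutator_mem μ M N hM hd P
    (fun _ hn v => P.toContRep_apply_eq_self_of_subset_closure μ N hN S₁ hD hdense hfix hn v) hcomm

end DiscreteAutomorphicRep

namespace UnitaryGroup

variable (F E : Type) [Field F] [NumberField F] [Field E] [NumberField E] [Algebra F E]
  (c : E ≃ₐ[F] E) (N : ℕ) (J : Matrix (Fin N) (Fin N) E)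
  [LocallyCompactSpace (adelicGroupData F E c N J).Adelic] [SecondCountableTopology (adelicGroupData F E c N J).Adelic]
  (μ : Measure (adelicGroupData F E c N J).automorphicQuotient) [(adelicGroupData F E c N J).IsAutomorphicMeasure μ]

/-- **Unitary data: one local fixing set + strong approximation + weak approximation at `∞` ⇒ automorphic character.**  For `𝒢 = U(J)(𝔸_F)` under
`hWA` (`U(J)(F)` dense in `U(J)(E ⊗ ℝ)`): if a closed normal `N₀ ≤ U(J)(𝔸_F)` contains all commutators `g⁻¹ (1,b)⁻¹ g (1,b)` with `b` finite-adelic,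
`N₀ ⊆ closure ⟨D ∪ S₁⟩` with `D ⊆ U(J)(F)` and `S₁` fixing every vector of `P`, then `P = ofChar ψ μ`.  On O8a: `N₀ = {det = 1}`, `S₁ = ι_{v₁}(SU_{v₁})`,
`D = SU(F)`, `hdense` = (M1). [cite: PlatonovRapinchuk1994, §7.3 Prop. 7.8, §7.4 Thm. 7.12] [cite: BorelJacquet1979, §4.6] -/
theorem exists_eq_ofChar_of_subset_closure_of_commutator_mem
    (hWA : DenseRange fun γ : (adelicGroupData F E c N J).Rational =>
      archPart F E c N J ((adelicGroupData F E c N J).toAdelic γ))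
    (P : DiscreteAutomorphicRep (adelicGroupData F E c N J) μ) (N₀ : Subgroup (adelicGroupData F E c N J).Adelic) [N₀.Normal]
    (hN₀ : IsClosed (N₀ : Set (adelicGroupData F E c N J).Adelic)) (S₁ : Set (adelicGroupData F E c N J).Adelic)
    {D : Set (adelicGroupData F E c N J).Adelic} (hD : D ⊆ ((adelicGroupData F E c N J).quotientSubgroup : Set _))
    (hdense : (N₀ : Set (adelicGroupData F E c N J).Adelic) ⊆
      closure ((Subgroup.closure (D ∪ S₁) : Subgroup (adelicGroupData F E c N J).Adelic) : Set _))
    (hfix : ∀ s ∈ S₁, ∀ v : P.space.toSubmodule, P.space.toContRep s v = v)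
    (hcomm : ∀ (b : finAdelic F E c N J) (g : (adelicGroupData F E c N J).Adelic),
      g⁻¹ * (finAdelicToAdelic F E c N J b)⁻¹ * g * finAdelicToAdelic F E c N J b ∈ N₀) :
    ∃ ψ : (adelicGroupData F E c N J).AutomorphicCharacter, P = DiscreteAutomorphicRep.ofChar ψ μ :=
  exists_eq_ofChar_of_forall_apply_eq_self_of_commutator_mem F E c N J μ hWA P N₀
    (fun _ hn v => P.toContRep_apply_eq_self_of_subset_closure μ N₀ hN₀ S₁ hD hdense hfix hn v) hcomm

end UnitaryGroup

end Literature.NumberTheory.Automorphic
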